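import Literature.MathematicalPhysics.QuantumFieldTheory.Balaban1983to89.B6TranslateV1
import Literature.MathematicalPhysics.QuantumFieldTheory.Balaban1983to89.B6MemberOfCubeV1L0
import Literature.MathematicalPhysics.QuantumFieldTheory.Balaban1983to89.B6TorusDepthDistanceL0
import Literature.MathematicalPhysics.QuantumFieldTheory.Balaban1983to89.B6Geom246MultiLevelBoxL0
import Literature.MathematicalPhysics.QuantumFieldTheory.Balaban1983to89.B6Geom246MultiLevelTorusL0
import Literature.MathematicalPhysics.QuantumFieldTheory.Balaban1983to89.B6GlobalChartV1L0
import Literature.MathematicalPhysics.QuantumFieldTheory.Balaban1983to89.B6MultiLevelTorusOperatorL0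
import Literature.MathematicalPhysics.QuantumFieldTheory.Balaban1983to89.B6TranslateTorusV1
/-!
# `Balaban1983to89.B6TranslateTorusV1L0` — LEVEL-0 TWIN (programme G-F3′-L0, director-ym LINE №27 / UV3-NODE §24.5; plan `lit-balaban-r03/G-F3L0-PLAN.md`) of `B6TranslateTorusV1`:
the same declarations, SAME NAMES AND STATEMENTS, for nested families WITH print's region `Λ₀ = T ∖ Ω₁` ADMITTED (structures
`B6MultiLevelBoxOperatorL0.Domains` / `B6MultiLevelTorusOperatorL0.TDomains`: levels `0, …, k`, the level-`0` block a single site, `Q′₀ = id`,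
finite weight `a₀` — print p.225 (2.14) «Σ_{j=0}^k … (Q′₀λ)(x) = λ(x), x ∈ Λ₀», p.229 «taking a sequence (2.1) … smallest possible domains B^j(Λ_j),
and considering the operator Δ_a defined by (2.19), (2.20) for this sequence»).  Every `D`-free object is the lineage's, consumed BY NAME; no existing
module is touched; no fact is minted.  Unit `lit-balaban-r03` (B6 fold owner, r03 gen 36); referee ref-4.  THE TWIN'S DOCUMENTATION FOLLOWS
VERBATIM (its «levels 1 … k» / «Ω₁ = X» sentences describe the twin; here `j` runs from `0` and `Ω₁` may be a proper subset).

# `Balaban1983to89.B6TranslateTorusV1` — T. Bałaban, *Propagators and renormalization transformations for lattice gauge theories. II*, Commun.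
# Math. Phys. **96** (1984) 223–250 [Balaban1984PropagatorsII], (2.1)–(2.4) p. 224, (2.45)–(2.46) p. 231, (2.19)/(2.22) p. 226 ON THE TORUS `T_η`:
# THE TORUS INSTANCE OF THE TRANSLATION COVARIANCE — p21's chart family `D.chart s` read as V1 domains IS the translate of `D` (`IsTr`), the V1
# translation is p21's `tshift` under the identity chart, the global `Δ_a`, `G = Δ_a⁻¹`, the local part `M = ∂*∂ + ∂∂* + Q*aQ` and `∂(1 − R)∂*` of the
# frame `D` ARE the conjugates `τ_{−v}·(same operator in the frame D.chart s)·τ_v`, and block majorants ∕ local majorants ∕ output localisation on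
# `geomT (D.chart s)` transport to `geomT D` along p21/p38's block map `blkMap` (an isometry of (2.46)) — ROUTE (A) of the B6 fold owner's programme for
# the genuine `k`-level Proposition 2.6 (B6-CLOSURE.md §5 item 13 addendum: per-cube work in the cube's chart, then conjugate)

statement-level skeleton of published theorems with citation tags; proofs where landed; nothing here is a claim about the Yang–Mills mass gap

PDF held: `paper:balaban1984-cmp96-propagators-rt-ii` (journal page = PDF page + 222); p. 224 [PDF 2] ((2.1)–(2.4)), p. 231 [PDF 9] ((2.45)–(2.46)),
p. 238 [PDF 16] (*"identify … a torus T_□"*), p. 247 [PDF 25] ((2.133)–(2.136)) re-read this generation; [Balaban1983RegularityDecay] p. 572 (torus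
conventions).

CITATION HEADER (lean-in-tree rule) — WHAT IS REPRODUCED.  Phase-2 file of the `lit-balaban` typed skeleton (HOME `run/shared/lean/pub/lit-balaban/`), unit
`lit-balaban-r03` (B6 fold owner; r03 gen 20, literature-prover-lit-balaban-r03-g20-0), referee ref-4.  SKELETON rows **B6.Eq2.1** × **B6.Eq2.45** ×
**B6.Eq2.19** × **B6.Eq2.22** × **B6.Prop2.6** (cells; decls of record untouched).  No display of the paper is a covariance statement; print uses the
torus translations tacitly (p. 238, p. 224 «T_η»).  IMPORTS BY NAME, restating nothing: `B6TranslateV1` (r03 g20: `tv`, `trV`, `IsTr`, `IsTr.idxB`,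
`UB`, `IsTr.GE_comm/deltaAE_comm/RE_US/QE_UB/aE_UI/QsE_UI`, `dcE_UB/dcsE_UP/dsE_UB/dE_US`, `iterBlockOf_add_tv`, `tv_neg`), `B6GlobalChartV1` (r03 g18:
`PV`, `toBox`, `domT`, `blkV1`), `B6MultiLevelTorusOperator` (p21: `TDomains`, `chart`, `chart_lev`, `tvec`, `pow_dvd_bigSide`, `tshift`, `twrap`),
`B6Geom246MultiLevelTorus` (p21: `geomT`, `bondT`, `blkMap`, `blkMap_blkOf`, `blkMap_injective`), `B6TorusDepthDistance` (p38: `distT_chart_eq`),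
`B6Geom246MultiLevelBox` (`bset`, `blkOf`, `exists_blkOf_eq`), `B6RandomWalk` (`HasMajorant`, `BlockSupp`), `B6Prop26Gluing` (`LocalMajorant`, `OutLoc`,
`mulOp`), `B6Ineq2133TwoScaleV1` (`onFun`), `B6AgreeLapV1Chart` (`onFun_comp`), `B6SectAOperatorsV1`/`B6SectAVectorModelV1` (`dE … QsE`, `RE`, `deltaAE`, `GE`),
`TorusLimitAxioms` (`PBond.translate(Equiv)` — the additive structure only).

## WHAT THIS FILE CERTIFIES (kernel-checked, 0 sorry, standard axioms; NO `def … : Prop`, no new named fact; definitions WITH BODIES: `TB` (the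
translation `τ_a` on bond functions as a linear endomorphism), `vch` (abbrev: the fine translation of the chart `s`))

* §1 **`dvd_tvec`** (`L^n ∣ (M·L^k)·s` for `n ≤ k + 1`), **`toBox_add_tv`** (`toBox (x + v) = tshift v (toBox x)`: the identity chart intertwines the V1
  translation with p21's torus translation), **`isTr_domT_chart`**: `IsTr (domT hN D hk) (domT hN (D.chart s) hk) ((M·L^k)·s)` — p21's CHART FAMILY READ AS
  V1 DOMAINS IS THE TRANSLATE OF THE ORIGINAL (so every covariance theorem of `B6TranslateV1` applies to the pair global frame ∕ chart frame),
  **`blkV1_translate`** (`blkV1 D (b + v) = blkMap D s (blkV1 (D.chart s) b)`), `blkMap_fst` (the block map keeps the level).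
* §2 **`TB a`** + `TB_mul_TB_neg`/`TB_neg_mul_TB`, **`onFun_UB`** (`onFun` of the `L²` translation is `τ_a`), **`onFun_conj`**/**`onFun_eq_conj`**
  (`T₂ ∘ U = U ∘ T₁` on `L²` ⟹ `onFun T₂ · τ = τ · onFun T₁`, `onFun T₁ = τ_{−a} · onFun T₂ · τ_a`), **`TB_mul_mulOp`**/**`mulOp_eq_conj`** (multiplications
  conjugate to multiplications by the translated function).
* §3 GENERIC TRANSPORTS along a permutation `φ` of the fine lattice and an injection `e` of block lattices with `blk₁ ∘ φ = e ∘ blk₂` and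
  `(T₁f)(φx) = (T₂(f ∘ φ))(x)`: **`hasMajorant_relabel`**, **`localMajorant_relabel`**, **`outLoc_relabel`**.
* §4 THE TORUS INSTANCE: `conj_apply`, **`hasMajorant_conj_chart`** (a `HasMajorant` on `geomT (D.chart s)` for `blkV1 hN (D.chart s)` gives one on `geomT D`
  for `blkV1 hN D` and the conjugate `τ_{−v} T₂ τ_v`), **`localMajorant_conj_chart`** (reach set carried by `blkMap`), **`outLoc_conj_chart`**, and
  **`kernel_blkMap`** (the standard kernels `C·F(level y)·e^{−δ d_T(y, y′)}` are PRESERVED by the block map — `distT_chart_eq`, `blkMap_fst`).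
* §5 THE GLOBAL OPERATORS ARE CONJUGATES OF THE CHART-FRAME ONES (weights pulled back along `IsTr.idxB`): **`onFun_GE_eq_conj`** (`G = Δ_a⁻¹`),
  **`onFun_deltaAE_eq_conj`** (`Δ_a`), **`localPart_comm`**/**`onFun_localPart_eq_conj`** (`M = ∂*∂ + ∂∂* + Q*aQ`, the minuend of
  `B6AgreeLapV1Chart.deltaAE_split`), **`dgPart_comm`**/**`onFun_dgPart_eq_conj`** (`∂(1 − R)∂*`, its subtrahend).

## HONEST SCOPE / DIVERGENCES

(1) Pure transport: no estimate is proved here; the value is that the per-cube ring data (`hagree`, `hinvl`) and the (2.133)/(2.134) majorants of the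
k-level Prop. 2.6 assembly may be established in p21's chart of each cube (where the cube is central and the owner's window machinery of
`B6AgreeLapV1Chart`/`B6AgreeQaQV1Chart`/`B6IndexCorrV1`/`B6MemberOfCubeV1` applies without wrap-around) and conjugated back to ONE global lattice.
(2) The block map is p21's `blkMap` (corner representatives); its isometry property is p38's `distT_chart_eq`.  (3) `M_h ≥ 1`, `P′_μ ≥ 1` as in p21's
torus files; `k ≤ m + K` (`hk`); the chart vector is `(M·L^k)·s`, divisible by every `L^n`, `n ≤ k + 1`.  (4) Nothing on the cube windows ((iii)) or the
assembly ((iv)) themselves.  Value = typed skeleton (transport lemmas); NOT summit progress.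
-/

noncomputable section

open scoped BigOperators
open Finset

namespace Literature.MathematicalPhysics.QuantumFieldTheory.Balaban1983to89.B6TranslateTorusV1L0

open LatticeFieldCalculus
open B5Eq118OneStroke (iterBlockOf iterBlockOf_zero iterBlockOf_succ)
open B6TranslateV1
open B6GlobalChartV1 (PV toBox toBox_apply)
open B6GlobalChartV1L0 (domT)
open B6MultiLevelBoxOperator (N0 bigSide)
open B6MultiLevelTorusOperator (tshift twrap tshift_val)
open B6MultiLevelTorusOperatorL0 (TDomains)
open B6Geom246MultiLevelBoxL0 (bset blkOf blkOf_val exists_blkOf_eq)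
open B6Geom246MultiLevelTorusL0 (geomT bondT blkMap blkMap_blkOf blkMap_injective blkMap_surjective)
open B4Reflection242 (boxDom mem_boxDom blk)
open Literature.MathematicalPhysics.QuantumFieldTheory.Balaban1983to89.B6TranslateTorusV1 (dvd_tvec toBox_add_tv TB TB_apply TB_mul_TB_neg TB_neg_mul_TB onFun_UB onFun_conj onFun_eq_conj TB_mul_mulOp mulOp_eq_conj hasMajorant_relabel localMajorant_relabel outLoc_relabel vch conj_apply)

variable {d ℓ : ℕ} {hd : 1 ≤ d + 1} {hL : Odd (ℓ + 1) ∧ 1 < ℓ + 1} {m K : ℕ}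
variable {Mh k R : ℕ} {P' : Fin (d + 1) → ℕ}

/-! ## §1  The chart vector `(M·L^k)·s` of p21's torus chart, the identity chart `toBox` and the V1 translation -/

section ChartVector

/-- **p21's CHART FAMILY READ AS A V1 DOMAIN DATUM IS THE TRANSLATE OF THE ORIGINAL ONE**: `domT (D.chart s)` and `domT D` are related by
`IsTr` with the vector `(M·L^k)·s` — so every covariance theorem of `B6TranslateV1` applies to the pair (global frame, chart frame).
[cite: Balaban1984PropagatorsII, (2.1)–(2.4) p.224, dictionary (charts)] -/
theorem isTr_domT_chart (hN : ∀ μ, N0 ℓ Mh k P' μ = (PV d ℓ m K hd hL).sitesPerDir 0) (D : TDomains d ℓ Mh k P' R) (hk : k ≤ m + K)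
    (s : Fin (d + 1) → ℤ) : IsTr (domT hN D hk) (domT hN (D.chart s) hk) (B6MultiLevelTorusOperator.TDomains.tvec ℓ Mh k s) where
  k_eq := rfl
  dvd μ := dvd_tvec (Nat.le_succ k) s μ
  mem_Om n y := by
    classical
    by_cases hn0 : n = 0
    · subst hn0
      simp [domT]
    by_cases hnk : n ≤ k
    · have hv : ∀ μ, (((PV d ℓ m K hd hL).L : ℤ) ^ n) ∣ B6MultiLevelTorusOperator.TDomains.tvec ℓ Mh k s μ := fun μ => dvd_tvec (by omega) s μ
      have hv' : ∀ μ, (((PV d ℓ m K hd hL).L : ℤ) ^ n) ∣ (-B6MultiLevelTorusOperator.TDomains.tvec ℓ Mh k s) μ := fun μ => by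
        rw [Pi.neg_apply]; exact (hv μ).neg_right
      simp only [domT, hn0, if_false, hnk, if_true, Finset.mem_filter, Finset.mem_univ, true_and]
      constructor
      · intro h x hx
        -- `x = x′ + v` with `iterBlockOf n x′ = y`
        have hx' : iterBlockOf n (x + tv (PV d ℓ m K hd hL) (-B6MultiLevelTorusOperator.TDomains.tvec ℓ Mh k s) 0) = y := by
          rw [iterBlockOf_add_tv n (le_trans hnk hk) hv', hx, tv_neg _ _ hv, add_neg_cancel_right]
        have := h _ hx'
        rw [B6MultiLevelTorusOperatorL0.TDomains.chart_lev, ← toBox_add_tv hN, add_assoc] at this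
        have h0 : tv (PV d ℓ m K hd hL) (-B6MultiLevelTorusOperator.TDomains.tvec ℓ Mh k s) 0 + tv (PV d ℓ m K hd hL) (B6MultiLevelTorusOperator.TDomains.tvec ℓ Mh k s) 0 = 0 := by
          rw [tv_neg _ _ (fun μ => dvd_tvec (Nat.zero_le _) s μ), neg_add_cancel]
        rwa [h0, add_zero] at this
      · intro h x hx
        rw [B6MultiLevelTorusOperatorL0.TDomains.chart_lev, ← toBox_add_tv hN]
        exact h _ (by rw [iterBlockOf_add_tv n (le_trans hnk hk) hv, hx])
    · have h1 : ¬ n ≤ k := hnk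
      simp [domT, hn0, h1]

/-- **THE BLOCK MAPS CORRESPOND**: the `D`-block of the translated bond is the image under p21's block map of the `D.chart s`-block of the bond.
[cite: Balaban1984PropagatorsII, (2.45) p.231, dictionary (charts)] -/
theorem blkV1_translate (hN : ∀ μ, N0 ℓ Mh k P' μ = (PV d ℓ m K hd hL).sitesPerDir 0) (D : TDomains d ℓ Mh k P' R) (hMh : 1 ≤ Mh)
    (hP : ∀ μ, 1 ≤ P' μ) (s : Fin (d + 1) → ℤ) (b : PBond (PV d ℓ m K hd hL) 0) :
    B6GlobalChartV1L0.blkV1 hN D (b.translate (tv (PV d ℓ m K hd hL) (B6MultiLevelTorusOperator.TDomains.tvec ℓ Mh k s) 0)) =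
      blkMap D s (B6GlobalChartV1L0.blkV1 hN (D.chart s) b) := by
  unfold B6GlobalChartV1L0.blkV1
  rw [blkMap_blkOf hMh hP, PBond.translate_src, toBox_add_tv]

/-- **THE BLOCK MAP KEEPS THE LEVEL**. [cite: Balaban1984PropagatorsII, (2.45) p.231, dictionary (charts)] -/
theorem blkMap_fst (D : B6MultiLevelTorusOperatorL0.TDomains d ℓ Mh k P' R) (hMh : 1 ≤ Mh) (hP : ∀ μ, 1 ≤ P' μ) (s : Fin (d + 1) → ℤ)
    (b : ↥(bset (D.chart s).toDomains)) : (blkMap D s b).1.1 = b.1.1 := by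
  obtain ⟨x, rfl⟩ := exists_blkOf_eq (D.chart s).toDomains b
  rw [blkMap_blkOf hMh hP, blkOf_val, blkOf_val]
  exact (B6MultiLevelTorusOperatorL0.TDomains.chart_lev D s x).symm

end ChartVector

/-! ## §2  Translation on the bond functions of the fine lattice, conjugation of `onFun` operators and of multiplications -/

section Conj

open B6Prop26Gluing (mulOp mulOp_apply)
open B6Ineq2133TwoScaleV1 (onFun onFun_apply)
open B6SectAOperatorsV1
open BalabanImbrieJaffe1984to88.BIJ85AxialPropagator411 (BondSpace)

variable {P : Params}

end Conj

/-! ## §3  Transport of block majorants, local majorants and output localisation along a relabelling of the fine lattice and of `𝔅` -/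

section Relabel

open B6RandomWalk (HasMajorant BlockSupp)
open B6Prop26Gluing (LocalMajorant OutLoc)

variable {g₁ g₂ : B6.Geometry} {X : Type}

end Relabel

/-! ## §4  The torus instance: operators in the chart frame `D.chart s` conjugate to the global frame `D`; their majorants on `geomT (D.chart s)`
become majorants on `geomT D` with the same distance- and level-dependent kernel -/

section Torus

open B6RandomWalk (HasMajorant)
open B6Prop26Gluing (LocalMajorant OutLoc mulOp)
open B6GlobalChartV1L0 (blkV1)
open B6TorusDepthDistanceL0 (blkIsoT distT_chart_eq)

variable (hN : ∀ μ, N0 ℓ Mh k P' μ = (PV d ℓ m K hd hL).sitesPerDir 0) (D : TDomains d ℓ Mh k P' R) (hMh : 1 ≤ Mh) (hP : ∀ μ, 1 ≤ P' μ)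
  (s : Fin (d + 1) → ℤ)

include hMh hP in
/-- **BLOCK MAJORANTS IN THE CHART FRAME ARE BLOCK MAJORANTS IN THE GLOBAL FRAME**: if `T₂` has the majorant `K` on `geomT (D.chart s)` for
the chart block map, and `K` depends on the blocks only through a quantity preserved by p21's block map (`hK`), then the conjugate
`τ_{-v} T₂ τ_v` has the majorant `K′` on `geomT D` for the global block map. [cite: Balaban1984PropagatorsII, (2.51) p.232 + (2.45)–(2.46) p.231, dictionary (charts)] -/
theorem hasMajorant_conj_chart {T₂ : Module.End ℝ (PBond (PV d ℓ m K hd hL) 0 → ℝ)}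
    {K : (B6Geom246MultiLevelTorusL0.geomT (D.chart s)).Site → (geomT (D.chart s)).Site → ℝ} {K' : (geomT D).Site → (geomT D).Site → ℝ}
    (h₂ : HasMajorant (g := geomT (D.chart s)) (blkV1 hN (D.chart s)) T₂ K)
    (hK : ∀ a b, K a b ≤ K' (blkMap D s a) (blkMap D s b)) (hK' : ∀ a b, 0 ≤ K' a b) :
    HasMajorant (g := geomT D) (blkV1 hN D) (TB (-vch Mh k s) * T₂ * TB (vch Mh k s)) K' :=
  hasMajorant_relabel (g₁ := geomT D) (g₂ := geomT (D.chart s)) (PBond.translateEquiv (vch Mh k s)) (blkMap D s)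
    (blkMap_injective hMh hP s) (blkV1 hN D) (blkV1 hN (D.chart s))
    (fun b => blkV1_translate hN D hMh hP s b) (fun f b => conj_apply s T₂ f b) h₂ hK hK'

include hMh hP in
/-- **LOCAL MAJORANTS IN THE CHART FRAME ARE LOCAL MAJORANTS IN THE GLOBAL FRAME** (reach set carried by the block map).
[cite: Balaban1984PropagatorsII, (2.133) p.247 + (2.45)–(2.46) p.231, dictionary (charts)] -/
theorem localMajorant_conj_chart {T₂ : Module.End ℝ (PBond (PV d ℓ m K hd hL) 0 → ℝ)} {S : Set (B6Geom246MultiLevelTorusL0.geomT (D.chart s)).Site}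
    {K : (geomT (D.chart s)).Site → (geomT (D.chart s)).Site → ℝ} {K' : (geomT D).Site → (geomT D).Site → ℝ}
    (h₂ : LocalMajorant (g := geomT (D.chart s)) (blkV1 hN (D.chart s)) T₂ S K)
    (hK : ∀ a b, K a b ≤ K' (blkMap D s a) (blkMap D s b)) :
    LocalMajorant (g := geomT D) (blkV1 hN D) (TB (-vch Mh k s) * T₂ * TB (vch Mh k s))
      (blkMap D s '' S) K' :=
  localMajorant_relabel (g₁ := geomT D) (g₂ := geomT (D.chart s)) (PBond.translateEquiv (vch Mh k s)) (blkMap D s)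
    (blkMap_injective hMh hP s) (blkV1 hN D) (blkV1 hN (D.chart s))
    (fun b => blkV1_translate hN D hMh hP s b) (fun f b => conj_apply s T₂ f b)
    (fun a => ⟨fun ha => by
        obtain ⟨a', ha', he⟩ := (Set.mem_image _ _ _).1 ha
        rwa [← blkMap_injective hMh hP s he], fun ha => Set.mem_image_of_mem _ ha⟩)
    (fun y hy => by
        obtain ⟨a, _, he⟩ := (Set.mem_image _ _ _).1 hy
        exact ⟨a, he⟩) h₂ hK

include hMh hP in
/-- **OUTPUT LOCALISATION IN THE CHART FRAME IS OUTPUT LOCALISATION IN THE GLOBAL FRAME**.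
[cite: Balaban1984PropagatorsII, (2.92)–(2.93) p.239, dictionary (charts)] -/
theorem outLoc_conj_chart {T₂ : Module.End ℝ (PBond (PV d ℓ m K hd hL) 0 → ℝ)} {S : Set (B6Geom246MultiLevelTorusL0.geomT (D.chart s)).Site}
    (h₂ : OutLoc (g := geomT (D.chart s)) (blkV1 hN (D.chart s)) T₂ S) :
    OutLoc (g := geomT D) (blkV1 hN D) (TB (-vch Mh k s) * T₂ * TB (vch Mh k s)) (blkMap D s '' S) :=
  outLoc_relabel (g₁ := geomT D) (g₂ := geomT (D.chart s)) (PBond.translateEquiv (vch Mh k s)) (blkMap D s) (blkV1 hN D)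
    (blkV1 hN (D.chart s)) (fun b => blkV1_translate hN D hMh hP s b) (fun f b => conj_apply s T₂ f b)
    (fun a => ⟨fun ha => by
        obtain ⟨a', ha', he⟩ := (Set.mem_image _ _ _).1 ha
        rwa [← blkMap_injective hMh hP s he], fun ha => Set.mem_image_of_mem _ ha⟩) h₂

include hMh hP in
/-- **THE STANDARD KERNELS ARE PRESERVED**: a kernel `C·F(level y)·e^{−δ·d_T(y,y′)}` on `geomT (D.chart s)` IS the same kernel on `geomT D` after
the block map (distance (2.46) and levels are chart-invariant: `distT_chart_eq`, `blkMap_fst`). [cite: Balaban1984PropagatorsII, (2.46) p.231, dictionary (charts)] -/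
theorem kernel_blkMap (F : ℕ → ℝ) (C δ : ℝ) (a b : (B6Geom246MultiLevelTorusL0.geomT (D.chart s)).Site) :
    C * F a.1.1 * Real.exp (-(δ * (geomT (D.chart s)).dist a b)) =
      C * F (blkMap D s a).1.1 * Real.exp (-(δ * (geomT D).dist (blkMap D s a) (blkMap D s b))) := by
  rw [blkMap_fst D hMh hP s a]
  show C * F a.1.1 * Real.exp (-(δ * (((bondT (D.chart s)).dist a b : ℕ) : ℝ))) =
    C * F a.1.1 * Real.exp (-(δ * (((bondT D).dist (blkMap D s a) (blkMap D s b) : ℕ) : ℝ)))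
  rw [distT_chart_eq hMh hP s]

end Torus

/-! ## §5  The global operators: `Δ_a`, `G`, the local part `M` and `∂P∂*` of the V1 torus in the frame `D` ARE the conjugates of the same operators
in the chart frame `D.chart s` (weights pulled back) -/

section Operators

open B6SectADomainsV1 B6SectAOperatorsV1 B6SectAVectorModelV1
open B6Ineq2133TwoScaleV1 (onFun)
open BalabanImbrieJaffe1984to88.BIJ85AxialPropagator411 (BondSpace)

variable (hN : ∀ μ, N0 ℓ Mh k P' μ = (PV d ℓ m K hd hL).sitesPerDir 0) (D : TDomains d ℓ Mh k P' R) (hk : k ≤ m + K) (s : Fin (d + 1) → ℤ)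

/-- **THE GLOBAL `G = Δ_a⁻¹` IS THE CONJUGATE OF THE CHART-FRAME `G`**: `onFun G(domT D, w) = τ_{-v} · onFun G(domT (D.chart s), w ∘ idxB) · τ_v`.
[cite: Balaban1984PropagatorsII, (2.22) p.226, dictionary (charts)] -/
theorem onFun_GE_eq_conj {c : ℝ} (hc : c ≠ 0) {w : BondIdx (domT hN D hk) → ℝ} (hw : ∀ i, 0 < w i) :
    onFun (GE (domT hN D hk) hc hw) =
      TB (-vch Mh k s) * onFun (GE (domT hN (D.chart s) hk) hc ((isTr_domT_chart hN D hk s).pos_comp_idxB hw)) *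
        TB (vch Mh k s) :=
  onFun_eq_conj _ ((isTr_domT_chart hN D hk s).GE_comm hc hw)

/-- **THE GLOBAL `Δ_a` IS THE CONJUGATE OF THE CHART-FRAME `Δ_a`**. [cite: Balaban1984PropagatorsII, (2.19) p.226, dictionary (charts)] -/
theorem onFun_deltaAE_eq_conj (c : ℝ) (w : BondIdx (domT hN D hk) → ℝ) :
    onFun (deltaAE (domT hN D hk) c w) =
      TB (-vch Mh k s) * onFun (deltaAE (domT hN (D.chart s) hk) c (w ∘ (isTr_domT_chart hN D hk s).idxB)) *
        TB (vch Mh k s) :=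
  onFun_eq_conj _ ((isTr_domT_chart hN D hk s).deltaAE_comm c w)

/-- **THE LOCAL PART `M = ∂*∂ + ∂∂* + Q*aQ` OF `Δ_a` IS COVARIANT** (the minuend of `B6AgreeLapV1Chart.deltaAE_split`).
[cite: Balaban1984PropagatorsII, (2.19) p.226, (2.91) p.239, dictionary (charts)] -/
theorem localPart_comm (c : ℝ) (w : BondIdx (domT hN D hk) → ℝ) :
    (dcsE (P := PV d ℓ m K hd hL) c ∘ₗ dcE c + dE c ∘ₗ dsE c +
        QsE (domT hN (D.chart s) hk) ∘ₗ aE (domT hN (D.chart s) hk) (w ∘ (isTr_domT_chart hN D hk s).idxB) ∘ₗ QE (domT hN (D.chart s) hk)) ∘ₗ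
        (UB (vch Mh k s)).toLinearEquiv.toLinearMap =
      (UB (vch Mh k s)).toLinearEquiv.toLinearMap ∘ₗ
        (dcsE c ∘ₗ dcE c + dE c ∘ₗ dsE c + QsE (domT hN D hk) ∘ₗ aE (domT hN D hk) w ∘ₗ QE (domT hN D hk)) := by
  have h := isTr_domT_chart hN D hk s
  apply LinearMap.ext; intro A
  simp only [LinearMap.comp_apply, LinearMap.add_apply, LinearEquiv.coe_coe, LinearIsometryEquiv.coe_toLinearEquiv, map_add, dcE_UB,
    dcsE_UP, dsE_UB, dE_US, h.QE_UB, h.aE_UI, h.QsE_UI]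

/-- **THE GLOBAL LOCAL PART IS THE CONJUGATE OF THE CHART-FRAME LOCAL PART**. [cite: Balaban1984PropagatorsII, (2.19) p.226, (2.91) p.239, dictionary (charts)] -/
theorem onFun_localPart_eq_conj (c : ℝ) (w : BondIdx (domT hN D hk) → ℝ) :
    onFun (dcsE (P := PV d ℓ m K hd hL) c ∘ₗ dcE c + dE c ∘ₗ dsE c + QsE (domT hN D hk) ∘ₗ aE (domT hN D hk) w ∘ₗ QE (domT hN D hk)) =
      TB (-vch Mh k s) *
        onFun (dcsE (P := PV d ℓ m K hd hL) c ∘ₗ dcE c + dE c ∘ₗ dsE c +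
          QsE (domT hN (D.chart s) hk) ∘ₗ aE (domT hN (D.chart s) hk) (w ∘ (isTr_domT_chart hN D hk s).idxB) ∘ₗ QE (domT hN (D.chart s) hk)) *
        TB (vch Mh k s) :=
  onFun_eq_conj _ (localPart_comm hN D hk s c w)

/-- **`∂P∂* = ∂(1 − R)∂*` IS COVARIANT** (the subtrahend of `deltaAE_split`). [cite: Balaban1984PropagatorsII, (2.19) p.226 («∂R∂*»), dictionary (charts)] -/
theorem dgPart_comm (c : ℝ) :
    (dE (P := PV d ℓ m K hd hL) c ∘ₗ (LinearMap.id - RE (B6GlobalChartV1L0.domT hN (D.chart s) hk) c) ∘ₗ dsE c) ∘ₗ (UB (vch Mh k s)).toLinearEquiv.toLinearMap =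
      (UB (vch Mh k s)).toLinearEquiv.toLinearMap ∘ₗ (dE c ∘ₗ (LinearMap.id - RE (domT hN D hk) c) ∘ₗ dsE c) := by
  have h := isTr_domT_chart hN D hk s
  apply LinearMap.ext; intro A
  simp only [LinearMap.comp_apply, LinearMap.sub_apply, LinearMap.id_apply, LinearEquiv.coe_coe, LinearIsometryEquiv.coe_toLinearEquiv,
    map_sub, dsE_UB, h.RE_US, dE_US]

/-- **THE GLOBAL `∂P∂*`-PART IS THE CONJUGATE OF THE CHART-FRAME ONE**. [cite: Balaban1984PropagatorsII, (2.19) p.226, dictionary (charts)] -/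
theorem onFun_dgPart_eq_conj (c : ℝ) :
    onFun (dE (P := PV d ℓ m K hd hL) c ∘ₗ (LinearMap.id - RE (B6GlobalChartV1L0.domT hN D hk) c) ∘ₗ dsE c) =
      TB (-vch Mh k s) * onFun (dE (P := PV d ℓ m K hd hL) c ∘ₗ (LinearMap.id - RE (domT hN (D.chart s) hk) c) ∘ₗ dsE c) *
        TB (vch Mh k s) :=
  onFun_eq_conj _ (dgPart_comm hN D hk s c)

end Operators

end Literature.MathematicalPhysics.QuantumFieldTheory.Balaban1983to89.B6TranslateTorusV1L0
end
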